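import Mathlib
import Summits.Ventures.HodgeRepro2.T6N1Main
import Summits.Ventures.HodgeRepro2.T6InterfaceToy

/-!
# T6N1Toy — non-vacuity of the N1 displays (README §10.5(ii)(c)–(d); owner t6-p1)

A kernel witness that the four displays of `T6N1Hyp` are JOINTLY SATISFIABLE and that the carriers of
`N1_main` are inhabited: over the lead's toy shadow (`Toy.toyShadow F`: `H^*(S, ℂ) := ℂ`, `∫_S := 0`) and
the trivial period datum (`Choice := Unit`, generators `0`), the N1 datum with complex conjugation on
`ℂ`, `H^{1,0} := ⊤`, the zero dictionary and `c_K := 1` satisfies `Voisin2002_7_3_2`,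
`Voisin2002_Lemma5_4_petersson`, `Liu2021_Prop4_13_vertexLiftA` and `…vertexLiftB` simultaneously
(`toy_displays`), and `N1_main` applies to it (`toy_N1_main`). Consequently no proof of
`Voisin2002_7_3_2 d → … → Liu2021_Prop4_13_vertexLiftB d → False` exists (§10.5(ii)(a): CANNOT, by
this witness). The witness is DEGENERATE (`∫_S = 0`, pairing `0`): a joint instance with a non-zero period
would need a toy surface side with a positive-definite Hodge form on `H^{2,0}` — not attempted.
§8(d): uses an L-value-free non-vanishing device: NO.
-/

namespace Summit.Ventures.HodgeRepro2.T6.N1Toy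

open scoped InnerProductSpace

variable {K : Type*} [Field K] [NumberField K]

/-- The trivial period datum over the toy shadow: one choice, admissible, generators `0`, base embedding
`σ₀`. -/
noncomputable def toyNDatum (F : FaceSetting K) (σ₀ : K →+* ℂ) : NDatum F where
  Choice := Unit
  AdmChoice _ := True
  shadow _ := Toy.toyShadow F
  τ₁ := σ₀
  e _ _ := 0
  e_mem _ _ := Submodule.zero_mem _

/-- The toy N1 datum: conjugation = complex conjugation on `H^*(S, ℂ) = ℂ`, `H^{1,0} = ⊤`, the zero
dictionary into `LG = ℂ`, `c_K = 1`, `F_A = F_B = 0`. -/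
noncomputable def toyN1 (F : FaceSetting K) (σ₀ : K →+* ℂ) :
    N1Datum F (toyNDatum F σ₀) ℂ (fun _ => 0) (fun _ => 0) where
  conj _ := starRingEnd ℂ
  conj_smul _ z x := by
    change starRingEnd ℂ (z * (@id ℂ x)) = starRingEnd ℂ z * starRingEnd ℂ (@id ℂ x)
    exact map_mul _ _ _
  conj_conj _ x := Complex.conj_conj (@id ℂ x)
  H10 _ := ⊤
  sc _ := 0
  cK := 1
  cK_pos := one_pos

/-- The four N1 displays hold jointly on the toy datum (§10.5(ii)(d)). -/
theorem toy_displays (F : FaceSetting K) (σ₀ : K →+* ℂ) :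
    Hyp.Voisin2002_7_3_2 (toyN1 F σ₀) ∧ Hyp.Voisin2002_Lemma5_4_petersson (toyN1 F σ₀) ∧
      Hyp.Liu2021_Prop4_13_vertexLiftA (toyN1 F σ₀) ∧ Hyp.Liu2021_Prop4_13_vertexLiftB (toyN1 F σ₀) := by
  refine ⟨fun _ => ⟨fun _ _ => Submodule.mem_top, fun _ _ => Submodule.mem_top⟩, ?_, ?_, ?_⟩
  · intro c _ ω _ ω' _
    change (0 : ℂ →ₗ[ℂ] ℂ) ((@id ℂ ω) * starRingEnd ℂ (@id ℂ ω')) =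
      ((1 : ℝ) : ℂ) * ⟪(0 : ℂ →ₗ[ℂ] ℂ) (@id ℂ ω'), (0 : ℂ →ₗ[ℂ] ℂ) (@id ℂ ω)⟫_ℂ
    simp
  · intro c _ i j _ _ _
    rfl
  · intro c _ k l _ _ _
    rfl

/-- The displays are not jointly refutable: a witness for `∃ d, H₁ d ∧ H₂ d ∧ H₃ d ∧ H₄ d`
(§10.5(ii)(a): `H₁ → H₂ → H₃ → H₄ → False` CANNOT be proved). -/
theorem displays_consistent (F : FaceSetting K) (σ₀ : K →+* ℂ) :
    ∃ d : N1Datum F (toyNDatum F σ₀) ℂ (fun _ => 0) (fun _ => 0),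
      Hyp.Voisin2002_7_3_2 d ∧ Hyp.Voisin2002_Lemma5_4_petersson d ∧
        Hyp.Liu2021_Prop4_13_vertexLiftA d ∧ Hyp.Liu2021_Prop4_13_vertexLiftB d :=
  ⟨toyN1 F σ₀, toy_displays F σ₀⟩

/-- `N1_main` applies to the toy datum (§10.5(ii)(c)–(d): the carriers are inhabited and the main's
hypotheses instantiate simultaneously; the conclusion is vacuous here since the toy pairing is `0`). -/
theorem toy_N1_main (F : FaceSetting K) (σ₀ : K →+* ℂ) :
    ∀ c : Unit, (toyNDatum F σ₀).AdmChoice c → (toyN1 F σ₀).pairing c ≠ 0 →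
      (toyNDatum F σ₀).I (toyNDatum F σ₀).τ₁ c ≠ 0 :=
  N1Main.N1_main (toyN1 F σ₀) (toy_displays F σ₀).1 (toy_displays F σ₀).2.1 (toy_displays F σ₀).2.2.1
    (toy_displays F σ₀).2.2.2

/-- The base-embedding binder `σ₀` is instantiable for every number field (Mathlib's
`NumberField.Embeddings.instNonemptyRingHom`): the toy datum exists for every face setting. -/
theorem exists_toyN1 (F : FaceSetting K) :
    ∃ (σ₀ : K →+* ℂ) (d : N1Datum F (toyNDatum F σ₀) ℂ (fun _ => 0) (fun _ => 0)),
      Hyp.Voisin2002_7_3_2 d ∧ Hyp.Voisin2002_Lemma5_4_petersson d ∧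
        Hyp.Liu2021_Prop4_13_vertexLiftA d ∧ Hyp.Liu2021_Prop4_13_vertexLiftB d :=
  let ⟨σ₀⟩ := (inferInstance : Nonempty (K →+* ℂ))
  ⟨σ₀, displays_consistent F σ₀⟩

end Summit.Ventures.HodgeRepro2.T6.N1Toy
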